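import Summits.QuantumAdvantage.QuantumAdvantage.Theorems.SosSandwichTransferPBWalkMachineAssembly
import HarnessLib

/-!
# Crux `TransferPB` (stmt-QuantumAdvantage-15238, route SosSandwich), line `birth` — the machine half reduced to ONE `FP` statement about ONE explicit machine family

Final form of the machine half of stub `stub_pbOracleSimulation`. The reference transcript machine never parses
the circuit family `F`: all quantum work sits in the promise oracle of (Q). So its width bound and budget can be
taken to be POLYNOMIALS evaluated at `|x|`:

* `machineBudget_eq_nat` — `machineBudget F x r c k = 2·B·(r(n)+1) + 1`, `B = 8T²·2^k·(400·d·(r(n)+1))^c`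
  (an honest natural number; no ceiling is taken);
* **`stub_pbOracleSimulation_of_polyTimeWalkMachines`** — the registered stub follows from
  (Q) `∀ c k F uniform r, nodeProblem F r c k ∈ PromiseBQP` and
  (P') `∀ pw pd : Polynomial ℕ, (walkMachine (fun x => pw.eval |x|) (fun x => pd.eval |x|)).IsPolyTime encodingBoolBool`
  — for a uniform `F` with size polynomial `s` (`IsUniform.isPolySize'`) the choices `pw = X + s ≥ oracleWidth` and
  `pd = 2·(8s²·2^k·(400(2s+1)(r+1))^c)·(r+1) + 1 ≥ machineBudget` qualify
  (`Theorems/SosSandwichTransferPBWalkMachineAssembly.lean`).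

(P') is a single statement about the explicit two-parameter family of step functions
`OracleComp.toStep (machineComp (pw ∘ length) (pd ∘ length) x)` (`Theorems/SosSandwichTransferPBWalkMachineDefs.lean`),
independent of `F`, `r`, `c`, `k`: the last piece of the machine half, pure `FP` programming
(`Literature/Computability/Complexity/{OracleStateMachine,AdaptivePrograms,StackPrograms}.lean` toolkits).
All proved here; (Q) and (P') are plain `Prop` arguments (no named fact).
Source: S. Aaronson, A. Ambainis, Theory Comput. 10 (2014), proof of Thm. 23 (p. 14).
-/

-- D-0017: single-conjunct summit ⇒ the duplicate `QuantumAdvantage.QuantumAdvantage` is mandated.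
set_option linter.dupNamespace false

noncomputable section

namespace Summit.QuantumAdvantage.QuantumAdvantage.Cruxes.TransferPB.Birth

open Finset Literature.Computability.Cryptography Literature.Computability.Complexity
  Literature.Computability.QuantumComplexity Literature.Computability.QuantumComplexity.ClassicalSimulation

namespace SimTreePB

section Final
open Summit.QuantumAdvantage.QuantumAdvantage.Theses.SosSandwich

variable {F : QCircuitFamily cliffordT} {x : List Bool} {r : Polynomial ℕ} {c k : ℕ}

/-- **The machine budget is an explicit natural number**: `machineBudget = 2·B·(r(n)+1) + 1` with
`B = 8T²·2^k·(400·d·(r(n)+1))^c`, `d = thm23Degree F x` (no ceiling is really taken). [folklore] -/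
theorem machineBudget_eq_nat :
    machineBudget F x r c k =
      2 * (8 * (F.circ x.length).oracleQueries ^ 2 * 2 ^ k * (400 * thm23Degree F x * (r.eval x.length + 1)) ^ c) *
        (r.eval x.length + 1) + 1 := by
  unfold machineBudget
  congr 1
  have hw := pbThreshold_pos F x r c k
  have hR : (0 : ℝ) < ((r.eval x.length : ℕ) : ℝ) + 1 := by positivity
  have key : 8 * ((F.circ x.length).oracleQueries : ℝ) ^ 2 /
      (pbThreshold F x r c k / 2 * (1 / (((r.eval x.length : ℕ) : ℝ) + 1))) =
      2 * (8 * ((F.circ x.length).oracleQueries : ℝ) ^ 2 / pbThreshold F x r c k) * ((((r.eval x.length : ℕ) : ℝ)) + 1) := by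
    field_simp
  rw [key, liveBound_eq]
  exact_mod_cast Nat.ceil_natCast _

/-- **`stub_pbOracleSimulation` from (Q) and ONE `FP` statement about ONE explicit machine family.** If
(Q) `nodeProblem F r c k ∈ PromiseBQP` for all `c, k`, uniform `F`, `r`, and (P') for every two polynomials
`pw, pd` the reference transcript machine with width bound `pw(|x|)` and budget `pd(|x|)` has a polynomial-time
step function, then the registered stub holds: for a uniform `F` with size polynomial `s`
(`IsUniform.isPolySize'`) the choices `pw = X + s` (`≥ n + ancillas(n) = oracleWidth`) and
`pd = 2·(8s²·2^k·(400(2s+1)(r+1))^c)·(r+1) + 1` (`≥ machineBudget`, `machineBudget_eq_nat`) qualify — the machine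
never parses `F`; all quantum work sits in the promise oracle of (Q). [cite: AaronsonAmbainis2014, Thm. 23 (proof, p. 14)] -/
theorem stub_pbOracleSimulation_of_polyTimeWalkMachines
    (hQ : ∀ (c k : ℕ) (F : QCircuitFamily cliffordT), F.IsUniform → ∀ r : Polynomial ℕ,
      nodeProblem F r c k ∈ Literature.Computability.Cryptography.PromiseBQP)
    (hP : ∀ pw pd : Polynomial ℕ,
      (walkMachine (fun x => pw.eval x.length) (fun x => pd.eval x.length)).IsPolyTime Computability.encodingBoolBool) :
    Sig.stub_pbOracleSimulation := by
  refine stub_pbOracleSimulation_of_polyTimeWalkMachine hQ fun c k F hF r => ?_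
  obtain ⟨s, hs⟩ := QCircuitFamily.IsUniform.isPolySize' hF
  let Lp : Polynomial ℕ :=
    Polynomial.C 8 * s ^ 2 * Polynomial.C (2 ^ k) * (Polynomial.C 400 * (Polynomial.C 2 * s + 1) * (r + 1)) ^ c
  let pw : Polynomial ℕ := Polynomial.X + s
  let pd : Polynomial ℕ := Polynomial.C 2 * Lp * (r + 1) + 1
  have hLp : ∀ n : ℕ, Lp.eval n = 8 * (s.eval n) ^ 2 * 2 ^ k * (400 * (2 * s.eval n + 1) * (r.eval n + 1)) ^ c := by
    intro n; simp [Lp]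
  have hpw : ∀ n : ℕ, pw.eval n = n + s.eval n := by intro n; simp [pw]
  have hpd : ∀ n : ℕ, pd.eval n = 2 * Lp.eval n * (r.eval n + 1) + 1 := by intro n; simp [pd]
  refine ⟨fun x => pw.eval x.length, fun x => pd.eval x.length, pw + pd, hP pw pd, fun x => ⟨?_, ?_, ?_, ?_⟩⟩
  · -- width
    show x.length + F.ancillas x.length ≤ pw.eval x.length
    rw [hpw]
    exact Nat.add_le_add_left (hs x.length).2 _
  · -- budget
    show machineBudget F x r c k ≤ pd.eval x.length
    rw [machineBudget_eq_nat, hpd, hLp]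
    have hT : (F.circ x.length).oracleQueries ≤ s.eval x.length :=
      (QCircuit.oracleQueries_le_size _).trans (hs x.length).1
    have hB := liveBoundNat_mono (r := r) (c := c) (k := k) hT
    gcongr
  · simp
  · simp

end Final

end SimTreePB

end Summit.QuantumAdvantage.QuantumAdvantage.Cruxes.TransferPB.Birth

end
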